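import Summits.ValiantsHypothesis.ValiantsHypothesis.Theses.ShallowShadows
import Literature.Computability.Complexity.FormulaComposition

/-!
# Crux `RazWigdersonMatching` (stmt-ValiantsHypothesis-17127), line `Sketch`: load-bearing hypotheses of the open stubs

Crux-disprover record (route `ShallowShadows`, line `Sketch` = idea `parity-harmonic`). The two
structural stubs of the line that are still open are

* `stub_kwPartition` (= `MonotoneKWPartition`): a `{∧₂, ∨₂}`-FORMULA `C` computing `f` yields a
  labelled rectangle partition of the monotone Karchmer–Wigderson game of `f` with at most
  `C.size + 1` parts;
* `stub_embedding` (= `BlockEmbedding`): for `2u + 1 ≤ n` a planted block embedding of pairs of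
  `u`-bit vectors into the monotone KW game of `perfectMatchingFn n`.

Both are true as stated (checked on paper; the embedding also exhaustively for small `n`). What
this file CERTIFIES is that their hypotheses cannot be weakened in the obvious ways, so that a
proof must use them:

* `kwPartition_false_without_isOver` — dropping `C.IsOver monotoneBasis` is FATAL even for
  formulas: the tree's straight-line model admits gates of any arity and truth table, and the
  single fat gate `∨₃` computes `x₀ ∨ x₁ ∨ x₂` with `size = 1`, while the monotone KW game of
  `∨₃` needs `3 > size + 1` labelled parts (the pairs `(eᵢ, 0)` have the unique answer `i`).
  So the leaf count `size + 1` is a statement about FAN-IN-2 gates: the potential argument must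
  charge every binary gate.
* `kwPartition_false_without_succ` — the `+ 1` cannot be dropped: the gate-free input circuit
  `x ↦ x 0` has `size = 0` but its KW game has a pair to cover.
* `blockEmbedding_false_without_spare_line` — the room hypothesis `2u + 1 ≤ n` cannot be
  weakened to `2u ≤ n`: at `u = n = 0` there is no cell to plant (certified below); at
  `(n, u) = (2, 1)` an exhaustive search over all `16⁴ · 4` candidate data `(eA, eB, p)` finds no
  planted embedding either (script `embed21.py`, attached as item evidence) — the planted answer
  needs its own row and column outside the `2u × 2u` block.
-/

namespace Summit.ValiantsHypothesis.ValiantsHypothesis.Theorems.RazWigdersonMatching.Negative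

-- summit = sub-problem name (single-conjunct summit, D-0017 layout), so the namespace repeats it
set_option linter.dupNamespace false

open Literature.Computability.Complexity Literature.Computability.Complexity.Circuit
open Literature.Barriers.PneNP

/-! ### `stub_kwPartition` without `IsOver monotoneBasis` -/

/-- **`IsOver monotoneBasis` is load-bearing in `stub_kwPartition`.** Without it the fat gate
`∨₃` (size `1`) would give a labelled rectangle partition of the monotone KW game of
`x₀ ∨ x₁ ∨ x₂` with at most `2` parts; but the three pairs `(eᵢ, 0)` have the unique answer `i`,
so their parts carry three distinct labels. [folklore] -/
theorem kwPartition_false_without_isOver :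
    ¬ ∀ (ι : Type) [Fintype ι] [DecidableEq ι] (f : (ι → Bool) → Bool) (C : Circuit ι),
        C.IsFormula → C.Computes f →
          ∃ L : ℕ, L ≤ C.size + 1 ∧
            ∃ (A : Fin L → Set (ι → Bool)) (B : Fin L → Set (ι → Bool)) (lab : Fin L → ι),
              (∀ x y, f x = true → f y = false → ∃! l, x ∈ A l ∧ y ∈ B l) ∧
              (∀ l x y, x ∈ A l → y ∈ B l → f x = true → f y = false →
                x (lab l) = true ∧ y (lab l) = false) := by
  intro H
  -- the one-gate circuit consisting of the fat gate `∨₃` reading the three inputs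
  let C : Circuit (Fin 3) :=
    { gates := [⟨3, fun v => decide (∃ i, v i = true), fun a => Sum.inl a⟩]
      output := .inr 0
      wf := by
        intro j h a m ha
        simp only [List.length_singleton, Nat.lt_one_iff] at h
        subst h
        simp at ha
      wf_output := by intro m h; cases h; simp }
  -- it is (trivially) a formula, computes `x ↦ x 0 ∨ x 1 ∨ x 2`, and has size `1`
  have hF : C.IsFormula := by
    intro m
    simp [C, Circuit.refCount]
  have hC : C.Computes fun x => decide (∃ i, x i = true) := fun _ => rfl
  have hS : C.size = 1 := rfl
  obtain ⟨L, hL, A, B, lab, hpart, hvalid⟩ := H (Fin 3) (fun x => decide (∃ i, x i = true)) C hF hC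
  rw [hS] at hL
  -- the unit vectors and the zero vector
  have hsurj : Function.Surjective lab := by
    intro i
    have hx : (decide (∃ j, (fun j => decide (j = i)) j = true)) = true := by
      simp
    have hy : (decide (∃ j, (fun _ : Fin 3 => false) j = true)) = false := by
      simp
    obtain ⟨l, ⟨hA, hB⟩, -⟩ := hpart (fun j => decide (j = i)) (fun _ => false) hx hy
    refine ⟨l, ?_⟩
    have := (hvalid l _ _ hA hB hx hy).1
    simpa using this
  have hcard := Fintype.card_le_of_surjective lab hsurj
  simp only [Fintype.card_fin] at hcard
  omega

/-! ### `stub_kwPartition` without the `+ 1` -/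

/-- **The `+ 1` (parts = gates + 1 = leaves) is load-bearing in `stub_kwPartition`.** The
gate-free input circuit `x ↦ x 0` over one variable has `size = 0`, but the pair `(1, 0)` of its
KW game must lie in some part. [folklore] -/
theorem kwPartition_false_without_succ :
    ¬ ∀ (ι : Type) [Fintype ι] [DecidableEq ι] (f : (ι → Bool) → Bool) (C : Circuit ι),
        C.IsOver monotoneBasis → C.IsFormula → C.Computes f →
          ∃ L : ℕ, L ≤ C.size ∧
            ∃ (A : Fin L → Set (ι → Bool)) (B : Fin L → Set (ι → Bool)) (lab : Fin L → ι),
              (∀ x y, f x = true → f y = false → ∃! l, x ∈ A l ∧ y ∈ B l) ∧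
              (∀ l x y, x ∈ A l → y ∈ B l → f x = true → f y = false →
                x (lab l) = true ∧ y (lab l) = false) := by
  intro H
  obtain ⟨L, hL, A, B, lab, hpart, -⟩ :=
    H (Fin 1) (fun x => x 0) (input 0) (isOver_input monotoneBasis _) (isFormula_input _).1
      (fun x => eval_input 0 x)
  rw [size_input] at hL
  obtain ⟨l, -, -⟩ := hpart (fun _ => true) (fun _ => false) rfl rfl
  exact absurd l.2 (by omega)

/-! ### `stub_embedding` with `2u ≤ n` only -/

/-- **The spare row/column (`2u + 1 ≤ n`) is load-bearing in `stub_embedding`.** With only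
`2u ≤ n` the case `u = n = 0` already has no cell `p` to plant. (At `(n, u) = (2, 1)` there is no
planted embedding either — exhaustive search, see the module docstring — so the failure is not an
artefact of `n = 0`.) [folklore] -/
theorem blockEmbedding_false_without_spare_line :
    ¬ ∀ (n u : ℕ), 2 * u ≤ n →
        ∃ (eA : (Fin u → Bool) → (Fin n × Fin n → Bool))
          (eB : (Fin u → Bool) → (Fin n × Fin n → Bool)) (p : Fin n × Fin n),
          (∀ x, perfectMatchingFn n (eA x) = true) ∧
          (∀ y, perfectMatchingFn n (eB y) = false) ∧
          (∀ x y, eA x p = true ∧ eB y p = false) ∧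
          (∀ x y, (Finset.univ.filter fun e : Fin n × Fin n =>
              eA x e = true ∧ eB y e = false).card =
            (Finset.univ.filter fun i : Fin u => (x i && y i) = true).card + 1) ∧
          (∀ x y (e : Fin n × Fin n), eA x e = true → eB y e = false →
            ∃ α β : Equiv.Perm (Fin n),
              (∀ c : Fin n × Fin n, eA x (α c.1, β c.2) = eA x c) ∧
              (∀ c : Fin n × Fin n, eB y (α c.1, β c.2) = eB y c) ∧
              (α p.1, β p.2) = e) := by
  intro H
  obtain ⟨-, -, p, -⟩ := H 0 0 le_rfl
  exact p.1.elim0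

end Summit.ValiantsHypothesis.ValiantsHypothesis.Theorems.RazWigdersonMatching.Negative
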